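import Mathlib
import Literature.NumberTheory.Transcendental.KZProductIdeal
import Literature.NumberTheory.Transcendental.MZVSimplexRepProofs
import Literature.NumberTheory.Transcendental.MZVShuffleRegularisation
import Literature.NumberTheory.Transcendental.Associators
import HarnessLib

/-!
# The formal period ring of the KZ calculus and the rules associator `Φ_P`

Definition file (request `defn-KZ.rulesAssociator`, D3 of route KontsevichZagierPeriods/FurushoPentagon:
items `PentagonInKZ` stmt-KontsevichZagierPeriods-4110 and `FurushoTransfer`
stmt-KontsevichZagierPeriods-5054). Everything lives over the Literature calculus of
`KZCalculus.lean` / `KZProduct.lean` / `KZProductIdeal.lean` (formal `ℤ`-combinations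
`KZ.FormalRep` of integral representations, the subgroup `KZ.relations` generated by the four
moves, the Fubini product `*`), the simplex representations `KZ.mzvRep` of multiple zeta values
(`MZVSimplexRep.lean`), the shuffle regularisation `MZV.shuffleReg` (`MZVShuffleRegularisation.lean`,
D2) and the associator vocabulary `NCSeries`, `IsGroupLike`, `DrinfeldPentagon`,
`GeneralisedDoubleShuffle` (`Associators.lean`, D1). No `Summits` import.

## Contents (everything stated here is proved; no named fact is introduced)

1. `KZ.IntegralRep.unit` — the 0-dimensional representation `[pt, 1]` (value `1`);
   `KZ.IntegralRep.unit_prod_eq_reindex`, `KZ.IntegralRep.prod_prod_eq_reindex` — `[pt,1] · s` and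
   `(r · s) · u` are coordinate relabellings (`KZ.IntegralRep.reindex` along `finCongr`) of `s` and of
   `r · (s · u)`, hence (`KZ.of_sub_of_reindex_mem_relations`) **the Fubini product is unital and
   associative modulo `KZ.relations`**: `KZ.of_unit_mul_sub_mem_relations`,
   `KZ.mul_of_unit_sub_mem_relations`, `KZ.mul_assoc_sub_mem_relations` (commutativity modulo
   relations is `KZ.mul_sub_mul_comm_mem_relations`, the two-sided ideal property
   `KZ.mul_sub_mul_mem_relations`, both in `KZProductIdeal.lean`).
2. `KZ.ringCon` and **the formal period ring `P = KZ.FormalPeriodRing := FormalRep ⧸ relations`**, a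
   `CommRing` (Kontsevich–Zagier's algebra `𝒫` of effective periods modulo the rules, for this
   calculus), with the quotient map `KZ.toFormalPeriod : FormalRep →ₙ+* P`
   (`toFormalPeriod_eq_iff`, `toFormalPeriod_eq_zero_iff : ⟦c⟧ = 0 ↔ c ∈ relations`, surjectivity,
   induction), the unit `1 = ⟦[pt, 1]⟧`, and the evaluation `KZ.evalP : P →+* ℝ` induced by
   `KZ.eval` (soundness `KZ.relations_le_ker_eval_holds`, multiplicativity `KZ.eval_mul'`);
   `P` is non-trivial.
3. **`P_ℚ = KZ.FormalPeriodAlgebra := ℚ ⊗[ℤ] P`**, a commutative `ℚ`-algebra, with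
   `KZ.toPeriodAlgebra : P →ₐ[ℤ] P_ℚ` (`p ↦ 1 ⊗ p`) and `KZ.evalPQ : P_ℚ →ₐ[ℚ] ℝ` (`= eval ⊗ ℚ`).
4. `KZ.mzvClass s : P` — the class of the simplex representation `KZ.mzvRep s` of an admissible
   index (`0` on non-admissible indices); `KZ.zetaConv`, `KZ.zetaFS` and
   **`KZ.zetaClass : List Bool → P_ℚ`** — `Z(w)`: on a CONVERGENT binary word `w` (empty, or first
   letter `0 = false = X₀` and last letter `1 = true = X₁`) the class of
   `KZ.mzvRep (MZV.ofBinaryWord w)`, on an arbitrary word `Σ_v reg(w)(v) · Z(v)` through the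
   two-sided shuffle regularisation `MZV.shuffleReg` (`reg(X₀) = reg(X₁) = 0`); `KZ.wordDepth w`
   (number of letters `X₁`).
5. **`KZ.rulesAssociator : NCSeries Bool P_ℚ`** — the RULES ASSOCIATOR
   `Φ_P := Σ_W (−1)^{depth W} Z(W) · W ∈ P_ℚ⟨⟨X₀, X₁⟩⟩`; sanity lemmas: constant term `1`
   (`rulesAssociator_nil`), `c_{X₀} = c_{X₁} = 0` (`rulesAssociator_X₀`, `rulesAssociator_X₁`),
   `c_W = (−1)^{dp W} ⟦mzvRep s⟧` on the convergent word `W` of an admissible index `s`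
   (`rulesAssociator_binaryWord`) with `evalPQ (c_W) = (−1)^{dp W} ζ(s)`
   (`evalPQ_rulesAssociator_binaryWord`, Kontsevich's formula `KZ.mzvRep_value_holds`), in particular
   `evalPQ (c_{X₀X₁}) = −ζ(2) = −π²/6` and `evalPQ (c_{X₁X₀}) = +ζ(2)` (`reg(X₁X₀) = −X₀X₁`).

## The sign / normalisation convention (recorded, as requested)

Drinfeld's KZ associator is the connection matrix of the KZ equation
`G′(u) = (A/u + B/(u−1)) G(u)`: with the solutions `G₀(u) ≈ u^A (u → 0)`, `G₁(u) ≈ (1−u)^B (u → 1)`,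
`G₀ = G₁ · Φ_KZ(A, B)` [Furusho2003, Def. 3.1.1 (= Def. 4.1.1 of arXiv:math/0011261); Drinfeld1991]. Writing
`Φ_KZ(A,B) = 1 + Σ_W I(W) W`, Furusho's explicit formula [Furusho2003, Prop. 3.2.3 (= Prop. 4.2.3 of
arXiv:math/0011261)] (by Le–Murakami's
method [LeMurakami1996, Thm A.9, whose signs Furusho corrects]) is: for a convergent word
`W ∈ M = A·𝔸·B`, `I(W) = (−1)^{dp W} Z(W)`, `dp W` = number of `B`'s and `Z(W)` the multiple zeta value
of `W` as Kontsevich's iterated integral of `du/u` (letter `A`) and `du/(1−u)` (letter `B`) over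
`1 > t₁ > ⋯ > t_w > 0`; for a general word `W = BʳVAˢ`, `I(W) = (−1)^{dp W} Z(reg W)` with `reg` the
shuffle regularisation killing `A` at the end and `B` at the front (ibid., second and third bullet:
`Σ_{a,b} (−1)^{a+b} f(Bᵃ ∘ B^{r−a}VA^{s−b} ∘ Aᵇ)`, `f` = projection onto `ℚ·1 + M`). Equivalently
[Furusho2011, §1]: `Φ_KZ(X₀,X₁) = 1 + Σ (−1)^m ζ(k₁,…,k_m) X₀^{k_m−1}X₁⋯X₀^{k₁−1}X₁ + (regularised
terms)` with `ζ(k₁,…,k_m) = Σ_{0<n₁<⋯<n_m} n₁^{−k₁}⋯n_m^{−k_m}`; in the tree's conventions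
(`multipleZeta`, decreasing `n`'s, FIRST entry `≥ 2`; `X₀ = false`, `X₁ = true`;
`MZV.binaryWord s = 0^{s₁−1}1⋯0^{s_k−1}1`; `KZ.mzvRep` integrates `dt/t`, `dt/(1−t)` over
`1 > t₁ > ⋯ > t_w > 0`) this says exactly: the coefficient of the convergent word `binaryWord s` is
`(−1)^{depth s} ζ(s)`. Hence `Φ_P(W) := (−1)^{wordDepth W} · Z(W)` with `Z` as in item 4, and
applying `evalPQ = KZ.eval ⊗ ℚ` coefficientwise gives Drinfeld's REAL `Φ_KZ(X₀, X₁)` on every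
convergent coefficient (`evalPQ_rulesAssociator_binaryWord`; e.g. `c_{X₀X₁} ↦ −ζ(2)`, matching
`Φ_KZ = 1 − ζ(2)[A,B] − ⋯` [Furusho2003, after Prop. 3.2.3] and `c_{X₀X₁} = μ²/24` with `μ = 2πi`),
and on every coefficient as soon as `MZV.shuffleReg` is shown to be the shuffle-regularisation
character of [IharaKanekoZagier2006, §2–3] (multiplicativity of `reg`, wanted by the route, not used
here). Since `reg` preserves the multiset of letters, putting the sign `(−1)^{depth}` outside or
inside the regularisation sum gives the same series.

## How the route's informal items become one-liners (NOT declared here: open statements belong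
to the route file, CONVENTIONS §4)

* `PentagonInKZ := NCSeries.DrinfeldPentagon KZ.rulesAssociator`;
* `GroupLike := NCSeries.IsGroupLike KZ.rulesAssociator` (⇐ ShuffleIsDissection stmt-3932 +
  multiplicativity of `MZV.shuffleReg`);
* `FurushoTransfer := NCSeries.IsGroupLike KZ.rulesAssociator → NCSeries.DrinfeldPentagon
  KZ.rulesAssociator → (ReducedPeriodRing ∧ IntegerDivision) → furusho_pentagon_doubleShuffle →
  NCSeries.GeneralisedDoubleShuffle KZ.rulesAssociator`.
Nothing in this file asserts the pentagon, group-likeness or any double shuffle relation.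

## References

* H. Furusho, *The multiple zeta value algebra and the stable derivation algebra*, Publ. RIMS 39
  (2003), 695–720, Def. 3.1.1, Prop. 3.2.3 (= Def. 4.1.1, Prop. 4.2.3 of arXiv:math/0011261, whose
  pages were read for this file). [Furusho2003]
* H. Furusho, *Double shuffle relation for associators*, Ann. of Math. 174 (2011), 341–360, §1–2
  (arXiv:0808.0319, pp. 3–5). [Furusho2011]
* T. T. Q. Le, J. Murakami, *Kontsevich's integral for the Kauffman polynomial*, Nagoya Math. J.
  142 (1996), 39–65, Thm A.9, (A.15). [LeMurakami1996]
* V. G. Drinfel'd, Leningrad Math. J. 2 (1991), 829–860. [Drinfeld1991]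
* M. Kontsevich, D. Zagier, *Periods* (2001), §1.1–1.2, §4.1 (the algebra `𝒫` of periods, the
  product by Fubini, `𝒫̂ = 𝒫[1/2πi]`). [KontsevichZagier2001]
* K. Ihara, M. Kaneko, D. Zagier, Compos. Math. 142 (2006), §2–3 (`reg_ш`). [IharaKanekoZagier2006]

## Design notes

* `KZ.FormalPeriodRing` is a `def` whose carrier is literally `FormalRep ⧸ relations` (the quotient
  by `QuotientAddGroup.leftRel relations`, which is the setoid of `KZ.ringCon`); its `CommRing`
  structure is the `NonUnitalNonAssocRing` structure of `KZ.ringCon.Quotient` (Mathlib) completed by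
  the unit `⟦[pt, 1]⟧` and the associativity/commutativity proved here. Being a `def`, it does not
  compete with Mathlib's additive-group instance on `FormalRep ⧸ relations` (the two agree
  definitionally).
* `KZ.FormalPeriodAlgebra` is an `abbrev` for `ℚ ⊗[ℤ] FormalPeriodRing`, so that Mathlib's
  `Algebra.TensorProduct` instances (`CommRing`, `Algebra ℚ`) apply as they are. The `ℤ`-module
  structures in the type are spelled `Algebra.toModule` (the form in which Mathlib states the ring
  structure of `A ⊗[R] B`), not the `AddCommGroup.toIntModule` that the bare notation `ℚ ⊗[ℤ] _`
  elaborates to: the two are definitionally equal but not reducibly so, and with the latter spelling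
  `simp`/`rw` fail on ring lemmas such as `neg_one_mul`. Downstream files should therefore write
  `KZ.FormalPeriodAlgebra` rather than `ℚ ⊗[ℤ] KZ.FormalPeriodRing`.
* `KZ.zetaConv v` is `0` unless `v` is a convergent word: `Z(w) = Σ_v reg(w)(v) Z(v)` therefore only
  reads `MZV.shuffleReg w` on convergent words (Furusho's projection `f`), and is the intended value
  independently of the (true, but not yet proved in the tree) fact that `reg(w)` is supported on
  convergent words. `KZ.mzvClass s` is `0` on non-admissible `s` (junk value, never reached from a
  convergent word: `MZV.isAdmissible_ofBinaryWord`).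
* Import hygiene (request `defn-KZRulesAssociatorProofs`): this file deliberately does NOT import
  `MultipleZetaValuesProofs.lean` (which would drag `MultipleZetaValues.lean` — Zagier's
  conjectures — and `PeriodsWave0.lean` into the import cone of every user of
  `KZ.rulesAssociator`). The two facts it used from there, `MZV.IsAdmissible [2]` and Euler's
  `multipleZeta [2] = π² / 6`, are re-derived below as the private lemmas `KZ.isAdmissible_two`,
  `KZ.multipleZeta_two` from material already in the cone (`ofReal_multipleZeta_singleton_holds`
  of `MultipleZetaProofs.lean` and Mathlib's `riemannZeta_two`); the statements and names of all
  public declarations are unchanged.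
-/

noncomputable section

open MeasureTheory Set
open scoped TensorProduct

namespace Literature.NumberTheory.Transcendental

namespace KZ

variable {n m l k : ℕ}

/-! ## 1. The unit representation and associativity of the Fubini product modulo relations -/

/-- Lebesgue measure of `ℝ⁰ = {pt}` is `1`. [folklore] -/
theorem volume_univ_fin_zero : volume (univ : Set (Fin 0 → ℝ)) = 1 := by
  rw [volume_pi, Measure.pi_univ]
  simp

namespace IntegralRep

/-- **The unit representation `[pt, 1]`**: the 0-dimensional integral representation with domain
the point `ℝ⁰` and integrand `1`; it represents `1` (`IntegralRep.value_unit`) and is the unit of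
the Fubini product modulo relations (`KZ.of_unit_mul_sub_mem_relations`).
[Kontsevich–Zagier 2001, §1.1 ("periods form a ring"), §4.1] [cite: KontsevichZagier2001, §4.1] -/
def unit : IntegralRep 0 where
  domain := univ
  integrand := fun _ => 1
  isSemialgebraic_domain := Literature.ModelTheory.ExponentialFields.isSemialgebraic_univ
  isSemialgebraicFunOn_integrand := by
    simpa using isSemialgebraicFunOn_aeval
      (Literature.ModelTheory.ExponentialFields.isSemialgebraic_univ (k := ℚ) (ι := Fin 0) (R := ℝ))
      (1 : MvPolynomial (Fin 0) ℚ)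
  integrableOn := integrableOn_const (hs := by simp [volume_univ_fin_zero])

/-- The domain of `[pt, 1]` is all of `ℝ⁰`. [KZ 2001, §4.1] [cite: KontsevichZagier2001, §4.1] -/
@[simp] theorem unit_domain : unit.domain = univ := rfl

/-- The integrand of `[pt, 1]` is `1`. [KZ 2001, §4.1] [cite: KontsevichZagier2001, §4.1] -/
@[simp] theorem unit_integrand : unit.integrand = fun _ => 1 := rfl

/-- **`value [pt, 1] = 1`.** [KZ 2001, §4.1] [cite: KontsevichZagier2001, §4.1] -/
@[simp] theorem value_unit : unit.value = 1 := by
  simp [value, Measure.restrict_univ, measureReal_def, volume_univ_fin_zero]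

variable (r : IntegralRep n) (s : IntegralRep m) (u : IntegralRep l)

/-- **`[pt, 1] · [τ, g]` is a relabelling of `[τ, g]`**: along `finCongr : Fin m ≃ Fin (0 + m)` the
product representation `unit.prod s` IS `s.reindex _` (equality of representations; the integrand
of the product is `1 ⊗ g` by `IntegralRep.prod_integrand_eq`). [folklore] -/
theorem unit_prod_eq_reindex : unit.prod s = s.reindex (finCongr (Nat.zero_add m).symm) := by
  have hcoord : ∀ (w : Fin (0 + m) → ℝ),
      (fun j => w (Fin.natAdd 0 j)) = fun i => w (finCongr (Nat.zero_add m).symm i) := by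
    intro w; funext j; simp
  refine ext' ?_ ?_
  · ext w
    simp only [prod_domain, mem_prodDomain, unit_domain, mem_univ, true_and, reindex_domain,
      mem_setOf_eq, hcoord]
  · rw [prod_integrand_eq, reindex_integrand]
    funext w
    rw [prodFun_apply, unit_integrand, one_mul, hcoord]

/-- **`([σ, f] · [τ, g]) · [υ, h]` is a relabelling of `[σ, f] · ([τ, g] · [υ, h])`** along
`finCongr (Nat.add_assoc n m l) : Fin (n + m + l) ≃ Fin (n + (m + l))`: both have domain
`σ × τ × υ` and integrand `f ⊗ g ⊗ h` (`IntegralRep.prod_integrand_eq`, `mul_assoc`).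
[Kontsevich–Zagier 2001, §4.1 ("periods form an algebra")] [cite: KontsevichZagier2001, §4.1] -/
theorem prod_prod_eq_reindex :
    (r.prod s).prod u = (r.prod (s.prod u)).reindex (finCongr (Nat.add_assoc n m l).symm) := by
  set e : Fin (n + (m + l)) ≃ Fin (n + m + l) := finCongr (Nat.add_assoc n m l).symm with he
  have h1 : ∀ (w : Fin (n + m + l) → ℝ),
      (fun i => w (e (Fin.castAdd (m + l) i))) = fun i => w (Fin.castAdd l (Fin.castAdd m i)) := by
    intro w; funext i; congr 1
  have h2 : ∀ (w : Fin (n + m + l) → ℝ),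
      (fun i => w (e (Fin.natAdd n (Fin.castAdd l i)))) =
        fun i => w (Fin.castAdd l (Fin.natAdd n i)) := by
    intro w; funext i; congr 1
  have h3 : ∀ (w : Fin (n + m + l) → ℝ),
      (fun j => w (e (Fin.natAdd n (Fin.natAdd m j)))) = fun j => w (Fin.natAdd (n + m) j) := by
    intro w; funext j; congr 1; exact Fin.ext (Nat.add_assoc _ _ _).symm
  refine ext' ?_ ?_
  · ext w
    simp only [prod_domain, mem_prodDomain, reindex_domain, mem_setOf_eq]
    rw [h1 w, h2 w, h3 w]
    tauto
  · rw [reindex_integrand, prod_integrand_eq, prod_integrand_eq]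
    funext w
    rw [prodFun_apply, prodFun_apply, prod_integrand_eq, prod_integrand_eq, prodFun_apply,
      prodFun_apply, h1 w, h2 w, h3 w, mul_assoc]

end IntegralRep

open IntegralRep in
/-- **Left unit modulo relations**: `[pt, 1] * c − c ∈ relations` for every formal combination `c`
(on generators `[pt,1] * [s] = [s.reindex _]`, a change-of-variables move away from `[s]`:
`unit_prod_eq_reindex`, `of_sub_of_reindex_mem_relations`; then additivity in `c`).
[Kontsevich–Zagier 2001, §4.1] [cite: KontsevichZagier2001, §4.1] -/
theorem of_unit_mul_sub_mem_relations (c : FormalRep) : of unit * c - c ∈ relations := by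
  induction c using FreeAbelianGroup.induction_on with
  | zero => simp [relations.zero_mem]
  | of x =>
    obtain ⟨m, s⟩ := x
    change of unit * of s - of s ∈ relations
    rw [of_mul_of, unit_prod_eq_reindex, ← neg_sub]
    exact relations.neg_mem (of_sub_of_reindex_mem_relations _ _)
  | neg x ih =>
    have : of unit * -FreeAbelianGroup.of x - -FreeAbelianGroup.of x =
        -(of unit * FreeAbelianGroup.of x - FreeAbelianGroup.of x) := by
      rw [mul_neg]; abel
    rw [this]; exact relations.neg_mem ih
  | add x y hx hy =>
    have : of unit * (x + y) - (x + y) = (of unit * x - x) + (of unit * y - y) := by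
      rw [mul_add]; abel
    rw [this]; exact relations.add_mem hx hy

open IntegralRep in
/-- **Right unit modulo relations**: `c * [pt, 1] − c ∈ relations` (left unit and commutativity
modulo relations, `mul_sub_mul_comm_mem_relations`). [Kontsevich–Zagier 2001, §4.1]
[cite: KontsevichZagier2001, §4.1] -/
theorem mul_of_unit_sub_mem_relations (c : FormalRep) : c * of unit - c ∈ relations := by
  have h := relations.add_mem (mul_sub_mul_comm_mem_relations c (of unit))
    (of_unit_mul_sub_mem_relations c)
  simpa using h

open IntegralRep in
/-- **Associativity modulo relations, on generators**: `([r] * [s]) * [u] − [r] * ([s] * [u]) ∈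
relations` (the relabelling `prod_prod_eq_reindex` is a change-of-variables move,
`of_sub_of_reindex_mem_relations`). [Kontsevich–Zagier 2001, §4.1] [cite: KontsevichZagier2001, §4.1] -/
theorem of_mul_of_mul_of_sub_mem_relations (r : IntegralRep n) (s : IntegralRep m)
    (u : IntegralRep l) :
    of r * of s * of u - of r * (of s * of u) ∈ relations := by
  rw [of_mul_of, of_mul_of, of_mul_of, of_mul_of, prod_prod_eq_reindex, ← neg_sub]
  exact relations.neg_mem (of_sub_of_reindex_mem_relations _ _)

/-- The values of an additive map `FormalRep →+ FormalRep` lie in `relations` as soon as its values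
on the generators `[r]` do (`relations` is a subgroup; induction on the free abelian group).
[folklore] -/
theorem map_mem_relations_of_forall_of (f : FormalRep →+ FormalRep)
    (h : ∀ (n : ℕ) (r : IntegralRep n), f (of r) ∈ relations) (x : FormalRep) :
    f x ∈ relations := by
  induction x using FreeAbelianGroup.induction_on with
  | zero => rw [map_zero]; exact relations.zero_mem
  | of X => obtain ⟨n, r⟩ := X; exact h n r
  | neg X ih => rw [map_neg]; exact relations.neg_mem ih
  | add X Y hX hY => rw [map_add]; exact relations.add_mem hX hY

/-- **Associativity modulo relations**: `(x * y) * z − x * (y * z) ∈ relations` for all formal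
combinations (from the generator case `of_mul_of_mul_of_sub_mem_relations`, the defect being
additive in each argument: `map_mem_relations_of_forall_of` three times).
[Kontsevich–Zagier 2001, §4.1] [cite: KontsevichZagier2001, §4.1] -/
theorem mul_assoc_sub_mem_relations (x y z : FormalRep) : x * y * z - x * (y * z) ∈ relations := by
  refine map_mem_relations_of_forall_of
    ((AddMonoidHom.mulRight z).comp (AddMonoidHom.mulRight y) - AddMonoidHom.mulRight (y * z))
    (fun n r => ?_) x
  change of r * y * z - of r * (y * z) ∈ relations
  refine map_mem_relations_of_forall_of
    ((AddMonoidHom.mulRight z).comp (AddMonoidHom.mulLeft (of r)) -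
      (AddMonoidHom.mulLeft (of r)).comp (AddMonoidHom.mulRight z))
    (fun m s => ?_) y
  change of r * of s * z - of r * (of s * z) ∈ relations
  refine map_mem_relations_of_forall_of
    (AddMonoidHom.mulLeft (of r * of s) -
      (AddMonoidHom.mulLeft (of r)).comp (AddMonoidHom.mulLeft (of s)))
    (fun l u => ?_) z
  exact of_mul_of_mul_of_sub_mem_relations r s u

/-! ## 2. The formal period ring `P = FormalRep ⧸ relations` -/

/-- **The ring congruence of the KZ calculus**: `c ~ d :⟺ −c + d ∈ relations` (the left-coset setoid
`QuotientAddGroup.leftRel relations` of the subgroup of relations), which is also a MULTIPLICATIVE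
congruence for the Fubini product because `relations` is a two-sided ideal
(`KZ.mul_sub_mul_mem_relations`). Its quotient carries the formal period ring.
[Kontsevich–Zagier 2001, §1.2, §4.1] [cite: KontsevichZagier2001, §4.1] -/
def ringCon : RingCon FormalRep where
  toSetoid := QuotientAddGroup.leftRel relations
  add' := (QuotientAddGroup.con relations).add'
  mul' := fun {a b c d} hab hcd => by
    rw [QuotientAddGroup.leftRel_apply] at hab hcd ⊢
    rw [neg_add_eq_sub] at hab hcd ⊢
    have h := mul_sub_mul_mem_relations hab hcd
    exact h

/-- Two formal combinations are congruent iff their difference is a relation. [folklore] -/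
theorem ringCon_apply {c d : FormalRep} : ringCon c d ↔ c - d ∈ relations := by
  change QuotientAddGroup.leftRel relations c d ↔ _
  rw [QuotientAddGroup.leftRel_apply, neg_add_eq_sub]
  exact ⟨fun h => by simpa using relations.neg_mem h, fun h => by simpa using relations.neg_mem h⟩

/-- In the quotient by `ringCon`, two classes agree iff the difference is a relation. [folklore] -/
theorem ringCon_coe_eq_coe_iff {c d : FormalRep} :
    ((c : ringCon.Quotient) = d) ↔ c - d ∈ relations := by
  rw [RingCon.eq, ringCon_apply]

/-- Associativity of `*` in the quotient `FormalRep / ~` (`mul_assoc_sub_mem_relations`). [folklore] -/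
theorem ringCon_mul_assoc (a b c : ringCon.Quotient) : a * b * c = a * (b * c) := by
  induction a using Quotient.inductionOn' with | h x => ?_
  induction b using Quotient.inductionOn' with | h y => ?_
  induction c using Quotient.inductionOn' with | h z => ?_
  change (x : ringCon.Quotient) * y * z = x * (y * z)
  rw [← RingCon.coe_mul, ← RingCon.coe_mul, ← RingCon.coe_mul, ← RingCon.coe_mul,
    ringCon_coe_eq_coe_iff]
  exact mul_assoc_sub_mem_relations x y z

/-- Commutativity of `*` in the quotient `FormalRep / ~` (`mul_sub_mul_comm_mem_relations`).
[folklore] -/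
theorem ringCon_mul_comm (a b : ringCon.Quotient) : a * b = b * a := by
  induction a using Quotient.inductionOn' with | h x => ?_
  induction b using Quotient.inductionOn' with | h y => ?_
  change (x : ringCon.Quotient) * y = y * x
  rw [← RingCon.coe_mul, ← RingCon.coe_mul, ringCon_coe_eq_coe_iff]
  exact mul_sub_mul_comm_mem_relations x y

/-- `⟦[pt, 1]⟧` is a left unit in the quotient `FormalRep / ~` (`of_unit_mul_sub_mem_relations`).
[folklore] -/
theorem ringCon_unit_mul (a : ringCon.Quotient) :
    ((of IntegralRep.unit : FormalRep) : ringCon.Quotient) * a = a := by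
  induction a using Quotient.inductionOn' with | h x => ?_
  change ((of IntegralRep.unit : FormalRep) : ringCon.Quotient) * x = x
  rw [← RingCon.coe_mul, ringCon_coe_eq_coe_iff]
  exact of_unit_mul_sub_mem_relations x

/-- `⟦[pt, 1]⟧` is a right unit in the quotient `FormalRep / ~` (`mul_of_unit_sub_mem_relations`).
[folklore] -/
theorem ringCon_mul_unit (a : ringCon.Quotient) :
    a * ((of IntegralRep.unit : FormalRep) : ringCon.Quotient) = a := by
  induction a using Quotient.inductionOn' with | h x => ?_
  change (x : ringCon.Quotient) * ((of IntegralRep.unit : FormalRep) : ringCon.Quotient) = x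
  rw [← RingCon.coe_mul, ringCon_coe_eq_coe_iff]
  exact mul_of_unit_sub_mem_relations x

/-- **The formal period ring `P := FormalRep ⧸ relations`** of the Kontsevich–Zagier calculus:
formal `ℤ`-combinations of integral representations modulo the subgroup generated by the four moves
(additivity, change of variables, Newton–Leibniz), with the product induced by the Fubini product of
representations — Kontsevich–Zagier's algebra `𝒫` of (effective, real, formal) periods "modulo the
rules" [Kontsevich–Zagier 2001, §1.2 and §4.1: "The space of effective periods forms an algebra
because the product of integrals is again an integral (Fubini formula)"], in the precise calculus of
`KZCalculus.lean`. The carrier is literally the quotient group `FormalRep ⧸ relations`; the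
commutative ring structure is `KZ.FormalPeriodRing.instCommRing`.
[cite: KontsevichZagier2001, §4.1] -/
def FormalPeriodRing : Type := FormalRep ⧸ relations

namespace FormalPeriodRing

/-- The carrier of the formal period ring is the quotient of `FormalRep` by the ring congruence
`KZ.ringCon` (definitionally). [folklore] -/
theorem eq_ringCon_quotient : FormalPeriodRing = ringCon.Quotient := rfl

/-- **`P = FormalRep ⧸ relations` is a commutative ring**: addition, negation and multiplication
descend from `FormalRep` (`relations` is a two-sided ideal: `KZ.ringCon`), the unit is the class of
`[pt, 1]`, associativity and the unit laws hold modulo relations by coordinate relabelling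
(`prod_prod_eq_reindex`, `unit_prod_eq_reindex`) and commutativity by the block flip
(`mul_sub_mul_comm_mem_relations`). [Kontsevich–Zagier 2001, §4.1] [cite: KontsevichZagier2001, §4.1] -/
instance instCommRing : CommRing FormalPeriodRing where
  __ := (inferInstance : NonUnitalNonAssocRing ringCon.Quotient)
  one := ((of IntegralRep.unit : FormalRep) : ringCon.Quotient)
  one_mul := ringCon_unit_mul
  mul_one := ringCon_mul_unit
  mul_assoc := ringCon_mul_assoc
  mul_comm := ringCon_mul_comm

/-- The formal period ring is inhabited (by `0`). [folklore] -/
instance instInhabited : Inhabited FormalPeriodRing := ⟨0⟩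

end FormalPeriodRing

/-- **The quotient map `FormalRep → P`**, `c ↦ ⟦c⟧`, a homomorphism of non-unital rings (the
canonical map from formal combinations of integral representations to formal periods).
[Kontsevich–Zagier 2001, §4.1] [cite: KontsevichZagier2001, §4.1] -/
def toFormalPeriod : FormalRep →ₙ+* FormalPeriodRing where
  toFun c := ((c : FormalRep) : ringCon.Quotient)
  map_mul' _ _ := rfl
  map_zero' := rfl
  map_add' _ _ := rfl

/-- `toFormalPeriod c` is the class of `c`. [folklore] -/
theorem toFormalPeriod_apply (c : FormalRep) :
    toFormalPeriod c = ((c : FormalRep) : ringCon.Quotient) :=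
  rfl

/-- **Two formal combinations have the same formal period iff they differ by a relation.**
[Kontsevich–Zagier 2001, §1.2] [cite: KontsevichZagier2001, §1.2] -/
theorem toFormalPeriod_eq_iff {c d : FormalRep} :
    toFormalPeriod c = toFormalPeriod d ↔ c - d ∈ relations :=
  ringCon_coe_eq_coe_iff

/-- **`⟦c⟧ = 0` iff `c` is a relation.** [Kontsevich–Zagier 2001, §1.2] [cite: KontsevichZagier2001, §1.2] -/
theorem toFormalPeriod_eq_zero_iff {c : FormalRep} : toFormalPeriod c = 0 ↔ c ∈ relations := by
  rw [← map_zero toFormalPeriod, toFormalPeriod_eq_iff, sub_zero]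

/-- Relations have formal period `0`. [folklore] -/
theorem toFormalPeriod_eq_zero_of_mem {c : FormalRep} (h : c ∈ relations) : toFormalPeriod c = 0 :=
  toFormalPeriod_eq_zero_iff.mpr h

/-- Equivalent representations have the same formal period. [folklore] -/
theorem Equivalent.toFormalPeriod_eq {r : IntegralRep n} {r' : IntegralRep m}
    (h : Equivalent r r') :
    toFormalPeriod (of r) = toFormalPeriod (of r') :=
  toFormalPeriod_eq_iff.mpr h

/-- Every formal period is the class of a formal combination. [folklore] -/
theorem toFormalPeriod_surjective : Function.Surjective toFormalPeriod :=
  Quotient.mk''_surjective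

/-- **The unit of `P` is the class of `[pt, 1]`.** [Kontsevich–Zagier 2001, §4.1] [cite: KontsevichZagier2001, §4.1] -/
theorem toFormalPeriod_of_unit : toFormalPeriod (of IntegralRep.unit) = 1 := rfl

/-- `⟦[r]⟧ * ⟦[s]⟧ = ⟦[r.prod s]⟧`: on classes of representations the product of `P` is the Fubini
product. [Kontsevich–Zagier 2001, §4.1] [cite: KontsevichZagier2001, §4.1] -/
theorem toFormalPeriod_of_mul_of (r : IntegralRep n) (s : IntegralRep m) :
    toFormalPeriod (of r) * toFormalPeriod (of s) = toFormalPeriod (of (r.prod s)) := by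
  rw [← map_mul, of_mul_of]

/-- **Induction on formal periods**: a property holding at `0` and at the classes `⟦[r]⟧` of
representations, stable under negation and addition, holds everywhere. [folklore] -/
theorem FormalPeriodRing.induction_on {p : FormalPeriodRing → Prop} (x : FormalPeriodRing)
    (zero : p 0)
    (hof : ∀ (n : ℕ) (r : IntegralRep n), p (toFormalPeriod (of r))) (neg : ∀ x, p x → p (-x))
    (add : ∀ x y, p x → p y → p (x + y)) : p x := by
  obtain ⟨c, rfl⟩ := toFormalPeriod_surjective x
  induction c using FreeAbelianGroup.induction_on with
  | zero => simpa using zero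
  | of X => obtain ⟨n, r⟩ := X; exact hof n r
  | neg X ih => rw [map_neg]; exact neg _ ih
  | add X Y hX hY => rw [map_add]; exact add _ _ hX hY

/-! ### Evaluation -/

/-- **Evaluation of formal periods** `evalP : P →+* ℝ`, `⟦c⟧ ↦ eval c`: well defined because every
relation evaluates to `0` (soundness of the calculus, `KZ.relations_le_ker_eval_holds`),
multiplicative by Fubini (`KZ.eval_mul'`), unital since `value [pt, 1] = 1`. Its image is the ring of
real effective periods; the Kontsevich–Zagier period conjecture for this calculus
(`KZKernelConjecture`) says it is injective. [Kontsevich–Zagier 2001, §1.2, §4.1]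
[cite: KontsevichZagier2001, §4.1] -/
def evalP : FormalPeriodRing →+* ℝ where
  toFun := Quotient.lift (eval : FormalRep → ℝ) fun a b (h : ringCon a b) => by
    rw [ringCon_apply] at h
    have h0 : eval (a - b) = 0 := relations_le_ker_eval_holds h
    rwa [map_sub, sub_eq_zero] at h0
  map_one' := by
    change eval (of IntegralRep.unit) = 1
    rw [eval_of, IntegralRep.value_unit]
  map_mul' x y := by
    induction x using Quotient.inductionOn' with | h c => ?_
    induction y using Quotient.inductionOn' with | h d => ?_
    exact eval_mul' c d
  map_zero' := by
    change eval (0 : FormalRep) = 0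
    exact map_zero eval
  map_add' x y := by
    induction x using Quotient.inductionOn' with | h c => ?_
    induction y using Quotient.inductionOn' with | h d => ?_
    exact map_add eval c d

/-- `evalP ⟦c⟧ = eval c`. [Kontsevich–Zagier 2001, §4.1] [cite: KontsevichZagier2001, §4.1] -/
@[simp] theorem evalP_toFormalPeriod (c : FormalRep) : evalP (toFormalPeriod c) = eval c := rfl

/-- `evalP ⟦[r]⟧ = value r`. [Kontsevich–Zagier 2001, §4.1] [cite: KontsevichZagier2001, §4.1] -/
theorem evalP_toFormalPeriod_of (r : IntegralRep n) : evalP (toFormalPeriod (of r)) = r.value := by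
  rw [evalP_toFormalPeriod, eval_of]

/-- **`P` is non-trivial**: `⟦[pt, 1]⟧ ≠ 0` since it evaluates to `1`. [folklore] -/
instance FormalPeriodRing.instNontrivial : Nontrivial FormalPeriodRing := evalP.domain_nontrivial

/-! ## 3. The `ℚ`-algebra `P_ℚ = ℚ ⊗ P` -/

/-- **The rational formal period algebra `P_ℚ := ℚ ⊗_ℤ P`**, a commutative `ℚ`-algebra (Mathlib's
`Algebra.TensorProduct` structure): the coefficient ring of the rules associator, in which the
shuffle regularisation (with its rational — in fact integral — coefficients) and Furusho's
`ℚ`-linear formalism of associators make sense. [Kontsevich–Zagier 2001, §4.1; Furusho 2011, §2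
(series over a commutative `ℚ`-algebra)] [cite: KontsevichZagier2001, §4.1] -/
abbrev FormalPeriodAlgebra : Type :=
  @TensorProduct ℤ _ ℚ FormalPeriodRing _ _ Algebra.toModule Algebra.toModule

/-- **The canonical map `P → P_ℚ`**, `p ↦ 1 ⊗ p` (Mathlib's `Algebra.TensorProduct.includeRight`).
[Kontsevich–Zagier 2001, §4.1] [cite: KontsevichZagier2001, §4.1] -/
def toPeriodAlgebra : FormalPeriodRing →ₐ[ℤ] FormalPeriodAlgebra :=
  Algebra.TensorProduct.includeRight

/-- `toPeriodAlgebra p = 1 ⊗ p`. [folklore] -/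
theorem toPeriodAlgebra_apply (p : FormalPeriodRing) : toPeriodAlgebra p = (1 : ℚ) ⊗ₜ[ℤ] p := rfl

/-- **Evaluation of `P_ℚ`**, `evalPQ = eval ⊗ ℚ : P_ℚ →ₐ[ℚ] ℝ`, `a ⊗ p ↦ a · evalP p`.
[Kontsevich–Zagier 2001, §4.1] [cite: KontsevichZagier2001, §4.1] -/
def evalPQ : FormalPeriodAlgebra →ₐ[ℚ] ℝ :=
  Algebra.TensorProduct.lift (Algebra.ofId ℚ ℝ) evalP.toIntAlgHom fun _ _ => Commute.all _ _

/-- `evalPQ (a ⊗ p) = a · evalP p`. [folklore] -/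
@[simp] theorem evalPQ_tmul (a : ℚ) (p : FormalPeriodRing) : evalPQ (a ⊗ₜ[ℤ] p) = a * evalP p := by
  simp [evalPQ]

/-- `evalPQ ∘ toPeriodAlgebra = evalP`. [folklore] -/
@[simp] theorem evalPQ_toPeriodAlgebra (p : FormalPeriodRing) :
    evalPQ (toPeriodAlgebra p) = evalP p := by
  rw [toPeriodAlgebra_apply, evalPQ_tmul, Rat.cast_one, one_mul]

/-! ## 4. Classes of multiple zeta values and the regularised assignment `Z` -/

/-- **The formal period `⟦ζ(s)⟧ ∈ P` of an index**: for an admissible index `s` the class of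
Kontsevich's simplex representation `KZ.mzvRep s` (domain `1 > t₁ > ⋯ > t_w > 0`, integrand
`∏ ω_{εᵢ}(tᵢ)` read off `MZV.binaryWord s`), fed with the two discharged analytic facts
`KZ.mzvIntegrand_isSemialgebraicFunOn_holds`, `KZ.mzvIntegrand_integrableOn_holds` — exactly the
classes the route's items `StuffleInKZ`, `HoffmanRelationInKZ`, `ShuffleIsDissection` are stated
with; junk value `0` on non-admissible indices. [Kontsevich–Zagier 2001, §1.1; Zagier 1994, §9]
[cite: KontsevichZagier2001, §1.1] -/
def mzvClass (s : List ℕ) : FormalPeriodRing :=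
  if hs : MZV.IsAdmissible s then
    toFormalPeriod (of (mzvRep s hs (mzvIntegrand_isSemialgebraicFunOn_holds s)
      (mzvIntegrand_integrableOn_holds s hs)))
  else 0

/-- `mzvClass` of an admissible index is the class of its simplex representation. [folklore] -/
theorem mzvClass_of_isAdmissible {s : List ℕ} (hs : MZV.IsAdmissible s) :
    mzvClass s = toFormalPeriod (of (mzvRep s hs (mzvIntegrand_isSemialgebraicFunOn_holds s)
      (mzvIntegrand_integrableOn_holds s hs))) := by
  rw [mzvClass, dif_pos hs]

/-- `mzvClass` of a non-admissible index is the junk value `0`. [folklore] -/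
theorem mzvClass_of_not_isAdmissible {s : List ℕ} (hs : ¬ MZV.IsAdmissible s) : mzvClass s = 0 := by
  rw [mzvClass, dif_neg hs]

/-- `mzvClass` agrees with any assignment `Z : List ℕ → FormalRep` of the shape used by the route's
items (`Z u = of (mzvRep u hu …)` on admissible `u`): `⟦Z u⟧ = mzvClass u`. [folklore] -/
theorem toFormalPeriod_eq_mzvClass {Z : List ℕ → FormalRep}
    (hZ : ∀ (u : List ℕ) (hu : MZV.IsAdmissible u), Z u = of (mzvRep u hu
      (mzvIntegrand_isSemialgebraicFunOn_holds u) (mzvIntegrand_integrableOn_holds u hu)))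
    {u : List ℕ} (hu : MZV.IsAdmissible u) : toFormalPeriod (Z u) = mzvClass u := by
  rw [hZ u hu, mzvClass_of_isAdmissible hu]

/-- **`evalP ⟦ζ(s)⟧ = ζ(s)`** for admissible `s` (Kontsevich's formula, `KZ.mzvRep_value_holds`).
[Kontsevich–Zagier 2001, §1.1; Zagier 1994, §9] [cite: KontsevichZagier2001, §1.1] -/
theorem evalP_mzvClass {s : List ℕ} (hs : MZV.IsAdmissible s) :
    evalP (mzvClass s) = multipleZeta s := by
  rw [mzvClass_of_isAdmissible hs, evalP_toFormalPeriod_of, mzvRep_value_holds]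

/-- The simplex representation of the empty index is the unit representation `[pt, 1]`
(domain `ℝ⁰`, empty product as integrand). [folklore] -/
theorem mzvRep_nil (h₁) (h₂) : mzvRep [] MZV.isAdmissible_nil h₁ h₂ = IntegralRep.unit := by
  haveI : IsEmpty (Fin (MZV.weight [])) := (inferInstance : IsEmpty (Fin 0))
  refine IntegralRep.ext' ?_ ?_
  · ext t
    simp only [mzvRep_domain, openOrderedSimplex, mem_setOf_eq, IsEmpty.forall_iff, true_and,
      IntegralRep.unit_domain]
    exact ⟨fun _ => trivial, fun _ a => isEmptyElim a⟩
  · funext t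
    simp [mzvRep, mzvIntegrand]

/-- **`⟦ζ(∅)⟧ = 1`**: the class of the empty index is the unit of `P`. [folklore] -/
@[simp] theorem mzvClass_nil : mzvClass [] = 1 := by
  rw [mzvClass_of_isAdmissible MZV.isAdmissible_nil, mzvRep_nil]
  rfl

/-- The binary word of an admissible index is convergent (empty, or starts with `0` and ends with
`1`). [Ihara–Kaneko–Zagier 2006, §1 (`𝔥⁰ = ℚ + x𝔥y`)] [cite: IharaKanekoZagier2006, §1] -/
theorem _root_.Literature.NumberTheory.Transcendental.MZV.isConvergentWord_binaryWord {s : List ℕ}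
    (hs : MZV.IsAdmissible s) : MZV.IsConvergentWord (MZV.binaryWord s) := by
  cases s with
  | nil => exact Or.inl rfl
  | cons a t =>
    exact Or.inr ⟨MZV.head?_binaryWord (hs.2 (List.cons_ne_nil a t)),
      MZV.getLast?_binaryWord (List.cons_ne_nil a t)⟩

/-- A convergent word does not start with the letter `1`, so its index is admissible
(`MZV.isAdmissible_ofBinaryWord`). [folklore] -/
theorem _root_.Literature.NumberTheory.Transcendental.MZV.IsConvergentWord.head?_ne {w : List Bool}
    (h : MZV.IsConvergentWord w) : w.head? ≠ some true := by
  rcases h with rfl | ⟨hh, -⟩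
  · simp
  · rw [hh]; simp

/-- The number of letters `X₁ = true` of a binary word (Furusho's `dp W`, the depth).
[Furusho 2003, §3.2 (before Prop. 3.2.3)] [cite: Furusho2003, Prop. 3.2.3] -/
def wordDepth (w : List Bool) : ℕ := w.count true

/-- `dp ∅ = 0`. [folklore] -/
@[simp] theorem wordDepth_nil : wordDepth [] = 0 := rfl

/-- `dp (X₁ W) = dp W + 1`. [folklore] -/
@[simp] theorem wordDepth_cons_true (w : List Bool) : wordDepth (true :: w) = wordDepth w + 1 := by
  simp [wordDepth]

/-- `dp (X₀ W) = dp W`. [folklore] -/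
@[simp] theorem wordDepth_cons_false (w : List Bool) : wordDepth (false :: w) = wordDepth w := by
  simp [wordDepth]

/-- `dp (U V) = dp U + dp V`. [folklore] -/
theorem wordDepth_append (u v : List Bool) : wordDepth (u ++ v) = wordDepth u + wordDepth v := by
  simp [wordDepth]

/-- The depth of the binary word `0^{s₁-1}1⋯0^{s_k-1}1` of an index is the depth `k` of the index.
[Zagier 1994, §9] [cite: Zagier1994, §9] -/
theorem wordDepth_binaryWord (s : List ℕ) : wordDepth (MZV.binaryWord s) = MZV.depth s := by
  induction s with
  | nil => rfl
  | cons a s ih =>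
    rw [MZV.binaryWord, wordDepth_append, wordDepth_append, ih]
    simp [wordDepth, MZV.depth, List.count_replicate]
    omega

/-- **`Z` on single words, convergent part**: `zetaConv v = ⟦ζ(ofBinaryWord v)⟧ ∈ P_ℚ` for a
CONVERGENT word `v` and `0` otherwise (the projection onto `ℚ·1 + M`, Furusho's `f`, built in).
[Furusho 2003, Prop. 3.2.3] [cite: Furusho2003, Prop. 3.2.3] -/
def zetaConv (v : List Bool) : FormalPeriodAlgebra :=
  if MZV.IsConvergentWord v then toPeriodAlgebra (mzvClass (MZV.ofBinaryWord v)) else 0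

/-- `zetaConv` of a convergent word. [folklore] -/
theorem zetaConv_of_isConvergentWord {v : List Bool} (h : MZV.IsConvergentWord v) :
    zetaConv v = toPeriodAlgebra (mzvClass (MZV.ofBinaryWord v)) := if_pos h

/-- `zetaConv` of a non-convergent word is `0`. [folklore] -/
theorem zetaConv_of_not_isConvergentWord {v : List Bool} (h : ¬ MZV.IsConvergentWord v) :
    zetaConv v = 0 := if_neg h

/-- **The `ℚ`-linear extension of `zetaConv` to `𝔥 = ℚ⟨X₀, X₁⟩ = (List Bool →₀ ℚ)`**
(`Finsupp.linearCombination`): `Σ_v a_v v ↦ Σ_v a_v Z(v)`. [folklore] -/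
def zetaFS : (List Bool →₀ ℚ) →ₗ[ℚ] FormalPeriodAlgebra := Finsupp.linearCombination ℚ zetaConv

/-- `zetaFS (a · v) = a · zetaConv v`. [folklore] -/
@[simp] theorem zetaFS_single (v : List Bool) (a : ℚ) :
    zetaFS (Finsupp.single v a) = a • zetaConv v :=
  Finsupp.linearCombination_single ℚ a v

/-- **The regularised assignment `Z : {binary words} → P_ℚ`**: `Z(w) := Σ_v reg(w)(v) · Z(v)`,
where `reg = MZV.shuffleReg` is the two-sided shuffle regularisation onto convergent words
(`reg(X₀) = reg(X₁) = 0`, identity on convergent words) and `Z(v) = ⟦ζ(ofBinaryWord v)⟧` on convergent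
`v`. On a convergent word this is the class of the simplex representation
(`zetaClass_of_isConvergentWord`); in general it is the formal-period version of Furusho's
`Z(f(Σ_{a,b} (−1)^{a+b} Bᵃ ∘ B^{r−a}VA^{s−b} ∘ Aᵇ))`, i.e. of the shuffle-regularised multiple zeta
value. [Furusho 2003, Prop. 3.2.3; Ihara–Kaneko–Zagier 2006, §3 (`reg_ш`)]
[cite: Furusho2003, Prop. 3.2.3] -/
def zetaClass (w : List Bool) : FormalPeriodAlgebra := zetaFS (MZV.shuffleReg w)

/-- **`Z` of a convergent word is the class of its simplex representation.**
[Furusho 2003, Prop. 3.2.3 (first case)] [cite: Furusho2003, Prop. 3.2.3] -/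
theorem zetaClass_of_isConvergentWord {w : List Bool} (h : MZV.IsConvergentWord w) :
    zetaClass w = toPeriodAlgebra (mzvClass (MZV.ofBinaryWord w)) := by
  rw [zetaClass, MZV.shuffleReg_of_isConvergentWord h, zetaFS_single, one_smul,
    zetaConv_of_isConvergentWord h]

/-- **`Z` of a convergent word, explicitly**: the class of
`KZ.of (KZ.mzvRep (MZV.ofBinaryWord w) _ (mzvIntegrand_isSemialgebraicFunOn_holds _)
(mzvIntegrand_integrableOn_holds _ _))` (the index of a convergent word is admissible,
`MZV.isAdmissible_ofBinaryWord`). [Furusho 2003, Prop. 3.2.3 (first case); Kontsevich–Zagier 2001,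
§1.1] [cite: Furusho2003, Prop. 3.2.3] -/
theorem zetaClass_eq_of_isConvergentWord {w : List Bool} (h : MZV.IsConvergentWord w) :
    zetaClass w = toPeriodAlgebra (toFormalPeriod (of (mzvRep (MZV.ofBinaryWord w)
      (MZV.isAdmissible_ofBinaryWord h.head?_ne)
      (mzvIntegrand_isSemialgebraicFunOn_holds (MZV.ofBinaryWord w))
      (mzvIntegrand_integrableOn_holds (MZV.ofBinaryWord w)
        (MZV.isAdmissible_ofBinaryWord h.head?_ne))))) := by
  rw [zetaClass_of_isConvergentWord h,
    mzvClass_of_isAdmissible (MZV.isAdmissible_ofBinaryWord h.head?_ne)]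

/-- `Z(binaryWord s) = ⟦ζ(s)⟧` for an admissible index `s`. [Furusho 2003, Prop. 3.2.3]
[cite: Furusho2003, Prop. 3.2.3] -/
theorem zetaClass_binaryWord {s : List ℕ} (hs : MZV.IsAdmissible s) :
    zetaClass (MZV.binaryWord s) = toPeriodAlgebra (mzvClass s) := by
  rw [zetaClass_of_isConvergentWord (MZV.isConvergentWord_binaryWord hs),
    MZV.ofBinaryWord_binaryWord hs.1]

/-- `Z(∅) = 1`. [folklore] -/
@[simp] theorem zetaClass_nil : zetaClass [] = 1 := by
  rw [zetaClass_of_isConvergentWord (Or.inl rfl), MZV.ofBinaryWord_nil, mzvClass_nil, map_one]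

/-- **`Z(X₀) = 0`** (`reg(X₀) = 0`, `MZV.shuffleReg_x`). [Ihara–Kaneko–Zagier 2006, §3]
[cite: IharaKanekoZagier2006, §3] -/
@[simp] theorem zetaClass_X₀ : zetaClass [false] = 0 := by
  rw [zetaClass, MZV.shuffleReg_x, map_zero]

/-- **`Z(X₁) = 0`** (`reg(X₁) = 0`, `MZV.shuffleReg_y`). [Ihara–Kaneko–Zagier 2006, §3]
[cite: IharaKanekoZagier2006, §3] -/
@[simp] theorem zetaClass_X₁ : zetaClass [true] = 0 := by
  rw [zetaClass, MZV.shuffleReg_y, map_zero]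

/-- **`Z(X₁X₀) = −Z(X₀X₁) = −⟦ζ(2)⟧`** (`reg(yx) = −xy`, `MZV.shuffleReg_yx`).
[Ihara–Kaneko–Zagier 2006, Cor. 5] [cite: IharaKanekoZagier2006, Cor. 5] -/
theorem zetaClass_yx : zetaClass [true, false] = -toPeriodAlgebra (mzvClass [2]) := by
  rw [zetaClass, MZV.shuffleReg_yx, map_neg, zetaFS_single, one_smul,
    zetaConv_of_isConvergentWord (Or.inr ⟨rfl, rfl⟩)]
  rfl

/-! ## 5. The rules associator -/

/-- **The rules associator `Φ_P ∈ P_ℚ⟨⟨X₀, X₁⟩⟩`** of route FurushoPentagon: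
`Φ_P := Σ_W (−1)^{dp W} Z(W) · W`, i.e. `c_W(Φ_P) = (−1)^{wordDepth W} · zetaClass W`, where `Z(W)` is
the shuffle-regularised class in `P_ℚ = ℚ ⊗ (FormalRep ⧸ relations)` of the simplex representations
of multiple zeta values (`KZ.zetaClass`). CONVENTION (see the module docstring): this is Drinfeld's
KZ associator `Φ_KZ(X₀, X₁)` — connection matrix `G₀ = G₁ Φ_KZ` of `G′(u) = (X₀/u + X₁/(u−1)) G(u)`,
`G₀ ≈ u^{X₀}`, `G₁ ≈ (1−u)^{X₁}` — with every (regularised) multiple zeta value replaced by its formal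
period: by [Furusho 2003, Prop. 3.2.3] / [Furusho 2011, §1] the coefficient of a convergent word `W`
in `Φ_KZ` is `(−1)^{dp W} ζ(W)` and that of a general word is `(−1)^{dp W}` times the
shuffle-regularised value, so that `evalPQ = eval ⊗ ℚ` applied coefficientwise yields the REAL
`Φ_KZ` (`evalPQ_rulesAssociator_binaryWord`: `c_{X₀X₁} ↦ −ζ(2)`, `c_{X₁X₀} ↦ +ζ(2)`, i.e.
`Φ_KZ = 1 − ζ(2)[X₀,X₁] + ⋯`). Nothing is asserted about `Φ_P`: the route's `PentagonInKZ` is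
`NCSeries.DrinfeldPentagon rulesAssociator`, its group-likeness is `NCSeries.IsGroupLike
rulesAssociator`. [Furusho 2003, Prop. 3.2.3; Furusho 2011, §1; Le–Murakami 1996, Thm A.9;
Drinfeld 1991] [cite: Furusho2003, Prop. 3.2.3] -/
def rulesAssociator : NCSeries Bool FormalPeriodAlgebra :=
  fun W => (-1) ^ wordDepth W * zetaClass W

/-- Unfolding the coefficients of the rules associator: `c_W(Φ_P) = (−1)^{dp W} Z(W)`.
[Furusho 2003, Prop. 3.2.3] [cite: Furusho2003, Prop. 3.2.3] -/
theorem rulesAssociator_apply (W : List Bool) :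
    rulesAssociator W = (-1) ^ wordDepth W * zetaClass W := rfl

/-- **Sanity: the constant term of `Φ_P` is `1`** (`Z(∅) = ⟦[pt, 1]⟧ = 1`).
[Furusho 2003, Prop. 3.2.3 (`Φ_KZ = 1 + Σ_W I(W) W`)] [cite: Furusho2003, Prop. 3.2.3] -/
@[simp] theorem rulesAssociator_nil : rulesAssociator [] = 1 := by
  simp [rulesAssociator_apply]

/-- **Sanity: `c_{X₀}(Φ_P) = 0`.** [Furusho 2003, §3.1 (`Φ_KZ ≡ 1` in the abelianisation)]
[cite: Furusho2003, Prop. 3.2.3] -/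
@[simp] theorem rulesAssociator_X₀ : rulesAssociator [false] = 0 := by
  simp [rulesAssociator_apply]

/-- **Sanity: `c_{X₁}(Φ_P) = 0`.** [Furusho 2003, §3.1 (`Φ_KZ ≡ 1` in the abelianisation)]
[cite: Furusho2003, Prop. 3.2.3] -/
@[simp] theorem rulesAssociator_X₁ : rulesAssociator [true] = 0 := by
  simp [rulesAssociator_apply]

/-- **The coefficient of a convergent word**: for an admissible index `s`,
`c_{binaryWord s}(Φ_P) = (−1)^{depth s} · ⟦ζ(s)⟧` — Furusho's `I(W) = (−1)^{dp W} Z(W)` for `W ∈ M`,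
with the multiple zeta value replaced by the class of its simplex representation.
[Furusho 2003, Prop. 3.2.3 (first case); Furusho 2011, §1] [cite: Furusho2003, Prop. 3.2.3] -/
theorem rulesAssociator_binaryWord {s : List ℕ} (hs : MZV.IsAdmissible s) :
    rulesAssociator (MZV.binaryWord s) = (-1) ^ MZV.depth s * toPeriodAlgebra (mzvClass s) := by
  rw [rulesAssociator_apply, wordDepth_binaryWord, zetaClass_binaryWord hs]

/-- **Faithfulness on convergent coefficients**: evaluating the coefficient of the convergent word
of an admissible index `s` gives `(−1)^{depth s} ζ(s)`, the corresponding coefficient of Drinfeld's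
real `Φ_KZ(X₀, X₁)` [Furusho 2011, §1: `Φ_KZ = 1 + Σ (−1)^m ζ(k₁,…,k_m) X₀^{k_m−1}X₁⋯X₀^{k₁−1}X₁ +
(regularised terms)`]. [cite: Furusho2011, §1] -/
theorem evalPQ_rulesAssociator_binaryWord {s : List ℕ} (hs : MZV.IsAdmissible s) :
    evalPQ (rulesAssociator (MZV.binaryWord s)) = (-1) ^ MZV.depth s * multipleZeta s := by
  rw [rulesAssociator_binaryWord hs, map_mul, map_pow, map_neg, map_one, evalPQ_toPeriodAlgebra,
    evalP_mzvClass hs]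

/-- The index `(2)` is admissible (a local copy of `MZV.isAdmissible_two` of
`MultipleZetaValuesProofs.lean`, which this file does not import — see the design notes).
[folklore] -/
private theorem isAdmissible_two : MZV.IsAdmissible [2] :=
  ⟨fun i hi => by simp only [List.mem_singleton] at hi; omega, fun _ => le_rfl⟩

/-- Euler: `ζ(2) = π² / 6` for the multiple zeta value of the index `(2)` (a local copy of
`multipleZeta_two` of `MultipleZetaValuesProofs.lean`, which this file does not import: depth one is
Riemann's zeta value, `ofReal_multipleZeta_singleton_holds`, then Mathlib's `riemannZeta_two`).
[folklore] -/
private theorem multipleZeta_two : multipleZeta [2] = Real.pi ^ 2 / 6 := by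
  have h := ofReal_multipleZeta_singleton_holds (k := 2) le_rfl
  rw [Nat.cast_ofNat, riemannZeta_two] at h
  exact_mod_cast h

/-- **Sanity: `c_{X₀X₁}(Φ_P) = −⟦ζ(2)⟧`.** [Furusho 2003, after Prop. 3.2.3 (`Φ_KZ = 1 − ζ(2)[A,B] − ⋯`)]
[cite: Furusho2003, Prop. 3.2.3] -/
theorem rulesAssociator_X₀X₁ : rulesAssociator [false, true] = -toPeriodAlgebra (mzvClass [2]) := by
  have h : MZV.binaryWord [2] = [false, true] := rfl
  rw [← h, rulesAssociator_binaryWord isAdmissible_two, show MZV.depth [2] = 1 from rfl,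
    pow_one, neg_one_mul]

/-- **Sanity: `c_{X₁X₀}(Φ_P) = +⟦ζ(2)⟧`** (`reg(X₁X₀) = −X₀X₁`). [Furusho 2003, after Prop. 3.2.3]
[cite: Furusho2003, Prop. 3.2.3] -/
theorem rulesAssociator_X₁X₀ : rulesAssociator [true, false] = toPeriodAlgebra (mzvClass [2]) := by
  rw [rulesAssociator_apply, zetaClass_yx, show wordDepth [true, false] = 1 from rfl, pow_one,
    neg_one_mul, neg_neg]

/-- **Sanity: `c_{X₀X₁}(Φ_P)` evaluates to `−ζ(2) = −π²/6`** (Kontsevich's formula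
`KZ.mzvRep_value_holds` and `multipleZeta_two`), as for Drinfeld's real `Φ_KZ`; together with the
hexagon normalisation `c_{X₀X₁} = μ²/24` this is `μ = ±2πi`. [Furusho 2003, after Prop. 3.2.3;
Furusho 2011, §1] [cite: Furusho2003, Prop. 3.2.3] -/
theorem evalPQ_rulesAssociator_X₀X₁ :
    evalPQ (rulesAssociator [false, true]) = -(Real.pi ^ 2 / 6) := by
  rw [rulesAssociator_X₀X₁, map_neg, evalPQ_toPeriodAlgebra, evalP_mzvClass isAdmissible_two,
    multipleZeta_two]

/-- **Sanity: `c_{X₁X₀}(Φ_P)` evaluates to `+ζ(2) = π²/6`.** [Furusho 2003, after Prop. 3.2.3]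
[cite: Furusho2003, Prop. 3.2.3] -/
theorem evalPQ_rulesAssociator_X₁X₀ : evalPQ (rulesAssociator [true, false]) = Real.pi ^ 2 / 6 := by
  rw [rulesAssociator_X₁X₀, evalPQ_toPeriodAlgebra, evalP_mzvClass isAdmissible_two,
    multipleZeta_two]

end KZ

end Literature.NumberTheory.Transcendental
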